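import Literature.NumberTheory.ComplexMultiplication.ShimuraTaniyamaOfMainTheorem
import Literature.NumberTheory.ComplexMultiplication.TorsionReciprocityReductionInertia
import HarnessLib

/-!
# Shimura–Taniyama (row II-5) from the Main Theorem of CM and the INERTIA form of Néron–Ogg–Šafarevič
# (consumer-side VI-NOS edition; [Shimura 1998, Thm. 19.8, Prop. 19.10, Thm. 19.11; Serre–Tate 1968 §7])

Topic `Literature/NumberTheory/ComplexMultiplication`, namespace `Literature.NumberTheory.ComplexMultiplication`.  THEOREMS ONLY
(no definition, no named fact, no instance; net Literature debt **0**).  Sibling of A-p04's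
`shimuraTaniyama_heckeCharacters_of_thm18_6` (p600904) with its two reduction-theory hypotheses
`h₁ : nonempty_goodReductionAt` (Néron-model DATUM) and `h₂ : nonempty_tateSpecialisation` (`ℓ`-adic specialisation DATUM of an ARBITRARY
`R`) replaced by the single inertia hypothesis the proof actually consumes (consumer trace of the cell `hodgecm-mathlib`, director
BATCH 68/71 «GO-lite»):

  `h₁₂ : ∀ k A₀ v, HasGoodReductionAt A₀.X A₀.dim v → ∀ ℓ [Fact ℓ.Prime], (ℓ : 𝓞 k) ∉ v.asIdeal →
           ∃ 𝔓 ∈ v.primesAbove, ∀ σ ∈ 𝔓.inertia (Field.absoluteGaloisGroup k), A₀.tateRep ℓ σ = 1`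

(«good reduction ⇒ `T_ℓ A₀` unramified at `v`», [SerreTate1968] §1 Thm. 1 easy direction / [Shimura1998] Lemma 19.5), which today's
facts imply (`forall_inertia_tateRep_eq_one_of_nonempty_goodReductionAt`) and which the abelian-scheme-model road will prove.  Proof =
A-p04's, character for character, with Thm. 19.11 read from `…_of_torsionReciprocity_of_inertia`.  HC_CM is proved only modulo the 7
printed citations until rung 0 closes; this file adds no hypothesis to anything.

## References
* [Shimura1998] G. Shimura, *Abelian Varieties with Complex Multiplication and Modular Functions* (1998): §19.7–19.11 (Thm. 19.8,
  Prop. 19.10, Thm. 19.11 and its proof), §18.6 Thm. 18.6 (2), Lemma 19.5.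
* [SerreTate1968] J.-P. Serre, J. Tate, *Good reduction of abelian varieties*, Ann. of Math. 88 (1968), §7 Thm. 10–12; §1 Thm. 1.
-/

noncomputable section
open CategoryTheory IsDedekindDomain NumberField
open scoped NumberField nonZeroDivisors

namespace Literature.NumberTheory.ComplexMultiplication

open Literature.AlgebraicGeometry.Motives
open Literature.NumberTheory.GaloisRepresentations

/-- **SHIMURA–TANIYAMA (Shimura 1998 Thm. 19.8 / Prop. 19.10 / Thm. 19.11 = Serre–Tate 1968 §7 Thms. 10–12) FROM THE MAIN THEOREM OF
COMPLEX MULTIPLICATION and the INERTIA form of good reduction.**  ASSUMING `shimura1998_thm18_6` (row II-1), the inertia hypothesis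
`h₁₂` («at a place of good reduction and for every `ℓ ∤ v`, some prime `𝔓 ∣ v` of `ℤ̄_k` has inertia acting trivially on `T_ℓ A₀`»)
and the converse of Néron–Ogg–Šafarevič `h₃` (`hasGoodReductionAt_of_isUnramifiedAt`), the named fact `shimuraTaniyama_heckeCharacters`
HOLDS.  Sibling of `shimuraTaniyama_heckeCharacters_of_thm18_6` (same assembly of steps 1–5).
[cite: Shimura1998, §19.7–19.11: Thm. 19.8, Prop. 19.10 (19.10a–e), Thm. 19.11 and its proof; §18.6 Thm. 18.6 (2); §8.5 Prop. 30]
[cite: SerreTate1968, §7 Thm. 10, Thm. 11 with Cor. 1, Thm. 12; §1 Thm. 1] -/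
theorem shimuraTaniyama_heckeCharacters_of_thm18_6_of_inertia (h186 : shimura1998_thm18_6)
    (h₁₂ : ∀ (k : Type) [Field k] [NumberField k] (A₀ : AbelianVariety k) (v : HeightOneSpectrum (𝓞 k)),
      HasGoodReductionAt A₀.X A₀.dim v → ∀ (ℓ : ℕ) [Fact ℓ.Prime], (ℓ : 𝓞 k) ∉ v.asIdeal →
        ∃ 𝔓 ∈ v.primesAbove, ∀ σ ∈ 𝔓.inertia (Field.absoluteGaloisGroup k), A₀.tateRep ℓ σ = 1)
    (h₃ : ∀ (k : Type) [Field k] [NumberField k] (A₀ : AbelianVariety k) (v : HeightOneSpectrum (𝓞 k)),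
      AbelianVariety.hasGoodReductionAt_of_isUnramifiedAt A₀ v) :
    shimuraTaniyama_heckeCharacters := by
  intro k _ _ _ K _ _ _ Φ A₀ ι₀ h
  classical
  -- 1. `K* ⊆ k` (Prop. 30) as instances
  have hK : ((traceField Φ : Set ℂ)) ⊆ Set.range (algebraMap k ℂ) := fun x hx => by
    have h' := h.traceField_le_fieldRange (show x ∈ (traceField Φ).toSubfield from hx)
    exact RingHom.mem_fieldRange.1 h'
  obtain ⟨_, _⟩ := exists_algebra_isScalarTower_of_subset_range (traceField Φ) k hK
  haveI : NumberField (traceField Φ) := NumberField.mk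
  -- 2. «We take `𝔞` so that (18.4a) holds»
  obtain ⟨𝔞, ⟨ξ⟩⟩ := h.exists_cmTypeUniformization
  -- 3. Thm. 19.8: `α`, lattice clause, reciprocity, `α = N_Φ` on `k^×`, `Ker(α)` open
  obtain ⟨α, hL, hR, hprin⟩ := exists_hom_torsion_reciprocity ξ h186
  have hideal : ∀ x : ideleGroup k, FractionalIdeal.spanSingleton (𝓞 K)⁰ ((α x : Kˣ) : K) =
      Literature.NumberTheory.Automorphic.FiniteAdeleRing.toFractionalIdeal (𝓞 K) K
        (reflexNormFinitePart K Φ (traceField Φ) (Literature.NumberTheory.AdelicBaseChange.ideleRelNorm (↥(traceField Φ)) k x)) :=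
    fun x => spanSingleton_eq_toFractionalIdeal_of_ideleMulIdeal_eq (hL x)
  have hker : IsOpen ((α.ker : Subgroup (ideleGroup k)) : Set (ideleGroup k)) := isOpen_ker_of_torsion_reciprocity ξ α hL hR
  -- 4. Prop. 19.10: the Hecke characters
  obtain ⟨χ, -, h1, h2, h3, hunr, hunits, h5⟩ := exists_heckeCharacters_of_isOpen_ker α hker hprin hideal
  -- 5. Thm. 19.11
  have h4 : ∀ v : HeightOneSpectrum (𝓞 k),
      (∀ u : (v.adicCompletionIntegers k)ˣ,
          α (localUnits v (Units.map ((v.adicCompletionIntegers k).subtype : _ →* _) u)) = 1) ↔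
        HasGoodReductionAt A₀.X A₀.dim v := fun v =>
    forall_localUnits_eq_one_iff_hasGoodReductionAt_of_torsionReciprocity_of_inertia ξ α hR
      (fun u => by
        obtain ⟨b, hb⟩ := hunits v u
        exact ⟨(b : 𝓞 K), hb.symm⟩)
      (fun hg ℓ _ hℓ => h₁₂ k A₀ v hg ℓ hℓ) (h₃ k A₀ v)
  refine ⟨χ, h1, h2, h3, fun τ v => (hunr τ v).trans (h4 v), fun v hv => ?_⟩
  obtain ⟨π, hπ, h5a, h5c⟩ := h5 v
  refine ⟨π, h5a, fun ℓ _ hℓ 𝔓 h𝔓 σ hσ => ?_, h5c⟩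
  exact tateRep_eq_tateModuleMap_of_isArithFrobAt_of_torsionReciprocity ξ α hR ((h4 v).2 hv) hπ.symm hℓ h𝔓 hσ

end Literature.NumberTheory.ComplexMultiplication

end
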